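import Literature.NumberTheory.EllipticCurves.Disegni2017.CyclotomicLineRankinSelberg
import Literature.NumberTheory.EllipticCurves.PAdicLFunctionNeZeroHoldsProofs
import Summits.BirchSwinnertonDyer.Rank1Residual.Additive.ChiBranchConstantTerm
import HarnessLib

/-!
# Disegni's interpolation values on the cyclotomic line ARE products of two Mazur–Tate–Teitelbaum
# branch values (STEP A of the kernel derivation of `delbourgoDatum_rankOne_leadingTerms`; cell
# `bsd-addord`, seat `bsd-addord-gz` gen 4)

HONEST FRAMING (cell `bsd-addord`, FULL-BSD rank-≤ 1 programme; PARTITION (D-0054): EXCLUDED-DOMAIN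
additive rows §E, B6 = O7-ord r1 × every consumer of the cell fact hFact — types-the-object-of; booked 0).
THEOREMS ONLY (no `def`, no named fact, no `sorry`). The literature seat typed Disegni 2017 Thm. A on
the cyclotomic line with COMPLEX central values (`Disegni2017.CycLineInterpolation`, p408713: at the
character `θ` mod `p^{m+1}` the value is `cycLineValue ι α θ Car (Λ 1) = α^{−2(m+1)} · ι⁻¹(u ·
τ(θ⁻¹ε)² · Car · Λ(1))`). This file proves the purely algebraic half of the comparison with the tree's
MTT branches at `p ≡ 1 (mod 4)` (even branch): GIVEN Birch's formula for two rational newforms `f, f′`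
at the even primitive character `ϑ = θ⁻¹·ε` (a tree THEOREM, `ratTwistedSymbolSum_mul_plusPeriod_holds`)
and a complex number `L = L₁·L₂` with `L_i` the continued central values, the Disegni value is

  `cycLineValue ι α θ Car (L₁ L₂) = c · v_f(χ_θ) · v_{f′}(χ_θ)`,  `c := ι⁻¹(u · Car · Ω⁺_f · Ω⁺_{f′})`,

where `χ_θ` is the `ℂ_p`-twin of `θ` (`CyclotomicLinePointsProofs`) and
`v_g(κ) = α^{−(m+1)} Σ_a κ(a) ω(a)^{(p−1)/2} [a/p^{m+1}]⁺_g` is EXACTLY the right-hand side of the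
tree's interpolation theorem `hasSum_coeff_padicLFunctionBranch_mul_pow_of_isNewformOf` for the
`ω^{(p−1)/2}`-branch. Ingredients: Euler's criterion for the Teichmüller character
(`teichRep_pow_half_eq_legendreSym`) — `ω(a)^{(p−1)/2} = (a/p)`, so the weight `teichWeight p (p/2)`
is the Legendre symbol, which `ι` fixes; transport of the rational symbol sums along `ι⁻¹`.

What is NOT here: the Artin factorisation (STEP B), uniqueness (p407505/p408296/p408899), heights (STEP C), odd `p`.
References: [Disegni2017] Thm. A (arXiv v3 PDF 7–8); [MazurTateTeitelbaum1986Invent] §I.8 (8.6),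
§I.13, §I.14 (14.3); cell sheet `run/shared/lean/pub/bsd-addord/lit/HFACT-KERNEL-INPUTS.md` §3 (c4)–(c5), §5.
-/

set_option autoImplicit false

noncomputable section

open scoped Classical MatrixGroups ModularForm NumberField

open CongruenceSubgroup WeierstrassCurve Literature.NumberTheory.EllipticCurves
  Literature.NumberTheory.EllipticCurves.ModularForms
  Literature.NumberTheory.EllipticCurves.Disegni2017

namespace Summit.BirchSwinnertonDyer.Rank1Residual.Additive

/-! ### §1 The weight `ω^{(p−1)/2}` is the Legendre symbol (all residues) -/

section Weight

variable (p : ℕ) [hp : Fact p.Prime]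

/-- **`teichWeight p (p/2) a = (a/p)`** for EVERY class `a` modulo `p^{e₀} = p` (`p` odd): Euler's
criterion on the units (`teichRep_pow_half_eq_legendreSym`), `0 = (a/p)` on the non-units.
[cite: MazurTateTeitelbaum1986Invent, §I.13] -/
theorem teichWeight_half_eq_legendreSym (hp2 : p ≠ 2) (a : ZMod (p ^ cyclotomicExponent p)) :
    teichWeight p (p / 2) a = (legendreSym p (a.val : ℤ) : ℚ_[p]) := by
  have hpP : p.Prime := hp.out
  have hpe : p ^ cyclotomicExponent p = p := pow_cyclotomicExponent_eq p hp2
  by_cases ha : IsUnit a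
  · rw [← ha.unit_spec, teichWeight_units, ← PadicInt.coe_pow, teichRep_pow_half_eq_legendreSym p hp2]
    simp
  · unfold teichWeight
    rw [dif_neg ha]
    -- `a` non-unit mod `p` ⇒ `p ∣ a.val` ⇒ `(a/p) = 0`
    have hcop : ¬ Nat.Coprime a.val (p ^ cyclotomicExponent p) := by
      intro h
      apply ha
      have hu := (ZMod.isUnit_iff_coprime a.val (p ^ cyclotomicExponent p)).mpr h
      rwa [ZMod.natCast_zmod_val] at hu
    have hdvdN : p ∣ a.val := by
      by_contra hnd
      exact hcop (Nat.Coprime.pow_right _ ((Nat.Prime.coprime_iff_not_dvd hpP).mpr hnd).symm)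
    have hdvd : (p : ℤ) ∣ (a.val : ℤ) := by exact_mod_cast hdvdN
    have h0 : legendreSym p (a.val : ℤ) = 0 :=
      (legendreSym.eq_zero_iff p _).mpr (by exact_mod_cast (ZMod.intCast_zmod_eq_zero_iff_dvd _ p).mpr hdvd)
    rw [h0]
    simp

/-- The weight read at level `p^{m+1}` through the reduction map: `teichWeight p (p/2) (b mod p) =
(b/p)`. [cite: MazurTateTeitelbaum1986Invent, §I.13] -/
theorem teichWeight_half_castHom (hp2 : p ≠ 2) {m : ℕ} (hm : cyclotomicExponent p ≤ m + 1)
    (b : ZMod (p ^ (m + 1))) :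
    teichWeight p (p / 2) (ZMod.castHom (pow_dvd_pow p hm) (ZMod (p ^ cyclotomicExponent p)) b) =
      (legendreSym p (b.val : ℤ) : ℚ_[p]) := by
  have hpP : p.Prime := hp.out
  have hpe : p ^ cyclotomicExponent p = p := pow_cyclotomicExponent_eq p hp2
  rw [teichWeight_half_eq_legendreSym p hp2]
  -- `((b mod p).val : ℤ)` and `(b.val : ℤ)` have the same Legendre symbol: they are congruent mod `p`
  have hval : ((ZMod.castHom (pow_dvd_pow p hm) (ZMod (p ^ cyclotomicExponent p)) b).val : ℤ) % p =
      (b.val : ℤ) % p := by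
    rw [ZMod.castHom_apply, ZMod.cast_eq_val, ZMod.val_natCast, hpe]
    push_cast
    exact Int.emod_emod_of_dvd _ (dvd_refl (p : ℤ))
  rw [legendreSym.mod p (((ZMod.castHom (pow_dvd_pow p hm) (ZMod (p ^ cyclotomicExponent p)) b).val : ℤ)),
    legendreSym.mod p (b.val : ℤ), hval]

end Weight

/-! ### §2 The quadratic character at level `p^n` takes the Legendre values -/

section Legendre

variable (p : ℕ) [hp : Fact p.Prime]

/-- **`legendreLevel p n b = (b/p)`** for every class `b` mod `p^n` (`n ≥ 1`): on units by
`changeLevel_eq_cast_of_dvd` and `legendreSym p a = quadraticChar (ZMod p) a`; on non-units both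
sides vanish. [cite: Disegni2017, Theorem A (the unit character α₀·ε; arXiv v3 PDF 8)] -/
theorem legendreLevel_apply {n : ℕ} (hn : n ≠ 0) (b : ZMod (p ^ n)) :
    legendreLevel p n hn b = (legendreSym p (b.val : ℤ) : ℂ) := by
  have hpP : p.Prime := hp.out
  haveI : NeZero (p ^ n) := ⟨pow_ne_zero _ hpP.ne_zero⟩
  by_cases hb : IsUnit b
  · obtain ⟨u, rfl⟩ := hb
    rw [legendreLevel, DirichletCharacter.changeLevel_eq_cast_of_dvd, MulChar.ringHomComp_apply,
      legendreSym, ZMod.cast_eq_val, Int.cast_natCast, eq_intCast]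
  · rw [MulChar.map_nonunit _ hb]
    have hcop : ¬ Nat.Coprime b.val (p ^ n) := by
      intro h
      apply hb
      have hu := (ZMod.isUnit_iff_coprime b.val (p ^ n)).mpr h
      rwa [ZMod.natCast_zmod_val] at hu
    have hdvdN : p ∣ b.val := by
      by_contra hnd
      exact hcop (Nat.Coprime.pow_right _ ((Nat.Prime.coprime_iff_not_dvd hpP).mpr hnd).symm)
    have hdvd : (p : ℤ) ∣ (b.val : ℤ) := by exact_mod_cast hdvdN
    have h0 : legendreSym p (b.val : ℤ) = 0 :=
      (legendreSym.eq_zero_iff p _).mpr (by exact_mod_cast (ZMod.intCast_zmod_eq_zero_iff_dvd _ p).mpr hdvd)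
    rw [h0, Int.cast_zero]

/-- The quadratic character at level `p^n` is its own inverse (`ε² = 1`).
[cite: Disegni2017, Theorem A (arXiv v3 PDF 8)] -/
theorem legendreLevel_inv {n : ℕ} (hn : n ≠ 0) :
    (legendreLevel p n hn)⁻¹ = legendreLevel p n hn := by
  have hpP : p.Prime := hp.out
  haveI : NeZero (p ^ n) := ⟨pow_ne_zero _ hpP.ne_zero⟩
  ext u
  rw [MulChar.inv_apply_eq_inv', legendreLevel_apply p hn]
  -- a unit has Legendre symbol `±1`, which is its own inverse
  have hne : ((((u : ZMod (p ^ n)).val : ℤ) : ZMod p)) ≠ 0 := by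
    intro h0
    rw [Int.cast_natCast, ZMod.natCast_eq_zero_iff] at h0
    have hcop := (ZMod.isUnit_iff_coprime (u : ZMod (p ^ n)).val (p ^ n)).mp
      (by rw [ZMod.natCast_zmod_val]; exact Units.isUnit u)
    have : Nat.Coprime (u : ZMod (p ^ n)).val p := (Nat.Coprime.coprime_dvd_right (dvd_pow_self p hn) hcop)
    exact hpP.ne_one ((Nat.coprime_comm.mp this).eq_one_of_dvd h0)
  rcases legendreSym.eq_one_or_neg_one p hne with h1 | h1 <;> rw [h1] <;> norm_num

/-- The quadratic character modulo `p` (`n = 1`) is primitive: its conductor divides the prime `p`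
and it is not trivial (`(a/p) = −1` for some `a`). [cite: Disegni2017, Theorem A (arXiv v3 PDF 8)] -/
theorem legendreLevel_one_isPrimitive (hp2 : p ≠ 2) :
    (legendreLevel p 1 one_ne_zero).IsPrimitive := by
  have hpP : p.Prime := hp.out
  haveI : NeZero (p ^ 1) := ⟨pow_ne_zero _ hpP.ne_zero⟩
  haveI : Fact (2 < p) := ⟨lt_of_le_of_ne hpP.two_le (Ne.symm hp2)⟩
  rw [DirichletCharacter.isPrimitive_def]
  have hdvd : (legendreLevel p 1 one_ne_zero).conductor ∣ p ^ 1 :=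
    DirichletCharacter.conductor_dvd_level _
  rcases (Nat.dvd_prime (by rw [pow_one]; exact hpP)).mp hdvd with h1 | h1
  · -- conductor 1 ⇒ trivial character ⇒ every unit has symbol 1: contradiction with a non-residue
    exfalso
    have htriv : legendreLevel p 1 one_ne_zero = 1 :=
      (DirichletCharacter.eq_one_iff_conductor_eq_one).mpr h1
    obtain ⟨a, ha⟩ := quadraticChar_exists_neg_one (F := ZMod p) (by rwa [ZMod.ringChar_zmod_n])
    -- lift `a ≠ 0` to a unit of `ZMod (p^1)`
    have ha0 : a ≠ 0 := by
      rintro rfl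
      rw [quadraticChar_zero] at ha
      norm_num at ha
    set b : ZMod (p ^ 1) := (a.val : ZMod (p ^ 1)) with hb
    have hbval : (b.val : ℤ) = (a.val : ℤ) := by
      rw [hb, ZMod.val_natCast, Nat.mod_eq_of_lt]
      rw [pow_one]; exact ZMod.val_lt a
    have hval := legendreLevel_apply p one_ne_zero b
    rw [htriv, hbval, legendreSym, Int.cast_natCast, ZMod.natCast_zmod_val, ha] at hval
    have hbu : IsUnit b := by
      rw [hb, ZMod.isUnit_iff_coprime, pow_one]
      refine (Nat.Prime.coprime_iff_not_dvd hpP).mpr ?_ |>.symm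
      intro hd
      apply ha0
      rw [← ZMod.natCast_zmod_val a, ZMod.natCast_eq_zero_iff]
      exact hd
    rw [MulChar.one_apply hbu] at hval
    norm_num at hval
  · exact h1

/-- **`θ⁻¹·ε` is primitive when `θ` is primitive of conductor `p^{m+1} ≥ p²`** (the quadratic factor has
conductor dividing `p`, so it cannot lower the conductor of `θ`). [cite: Disegni2017, Theorem A (arXiv v3 PDF 8)] -/
theorem isPrimitive_inv_mul_legendreLevel {m : ℕ} (hm1 : 1 ≤ m)
    {θ : DirichletCharacter ℂ (p ^ (m + 1))} (hθ : θ.IsPrimitive) :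
    (θ⁻¹ * legendreLevel p (m + 1) (Nat.succ_ne_zero m)).IsPrimitive := by
  have hpP : p.Prime := hp.out
  haveI : NeZero (p ^ (m + 1)) := ⟨pow_ne_zero _ hpP.ne_zero⟩
  set ε := legendreLevel p (m + 1) (Nat.succ_ne_zero m) with hε
  set ϑ := θ⁻¹ * ε with hϑ
  rw [DirichletCharacter.isPrimitive_def]
  by_contra hne
  -- `cond ϑ ∣ p^m`
  have hdvd : ϑ.conductor ∣ p ^ (m + 1) := DirichletCharacter.conductor_dvd_level _
  obtain ⟨k, hk, hkeq⟩ := (Nat.dvd_prime_pow hpP).mp hdvd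
  have hkm : k ≤ m := by
    by_contra hkm
    have : k = m + 1 := by omega
    exact hne (by rw [hkeq, this])
  have hϑm : ϑ.conductor ∣ p ^ m := by rw [hkeq]; exact pow_dvd_pow p hkm
  -- `cond ε ∣ p ∣ p^m`
  have hεfac : ε.FactorsThrough p := by
    have h := DirichletCharacter.changeLevel_factorsThrough
      ((quadraticChar (ZMod p)).ringHomComp (Int.castRingHom ℂ)) (dvd_pow_self p (Nat.succ_ne_zero m))
    exact h
  have hεm : ε.conductor ∣ p ^ m :=
    (DirichletCharacter.conductor_dvd_of_mem_conductorSet _ hεfac).trans (dvd_pow_self p (by omega))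
  -- `θ⁻¹ = ϑ · ε⁻¹ = ϑ · ε`, so `cond θ⁻¹ ∣ lcm ∣ p^m`
  have hεinv : ε⁻¹ = ε := by rw [hε]; exact legendreLevel_inv p (Nat.succ_ne_zero m)
  have hεε : ε * ε = 1 := by
    nth_rewrite 1 [← hεinv]
    exact inv_mul_cancel ε
  have hθinv : θ⁻¹ = ϑ * ε := by
    rw [hϑ, mul_assoc, hεε, mul_one]
  have hcond : θ⁻¹.conductor ∣ p ^ m := by
    rw [hθinv]
    exact (DirichletCharacter.conductor_mul_dvd_lcm_conductor ϑ ε).trans (Nat.lcm_dvd hϑm hεm)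
  rw [DirichletCharacter.conductor_inv, hθ] at hcond
  have := Nat.pow_dvd_pow_iff_le_right hpP.one_lt |>.mp hcond
  omega

/-- An even character of `p`-power order modulo `p` (`m = 0`) is trivial.
[cite: MazurTateTeitelbaum1986Invent, §I.13] -/
theorem eq_one_of_orderOf_eq_prime_pow_level_prime {θ : DirichletCharacter ℂ (p ^ (0 + 1))}
    (hord : ∃ j : ℕ, orderOf θ = p ^ j) : θ = 1 := by
  have hpP : p.Prime := hp.out
  haveI : Fact (Nat.Prime (p ^ (0 + 1))) := ⟨by rw [zero_add, pow_one]; exact hpP⟩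
  obtain ⟨j, hj⟩ := hord
  have hpow : θ ^ (p ^ (0 + 1) - 1) = 1 := by
    ext a
    have ha : ((a : ZMod (p ^ (0 + 1))) ^ (p ^ (0 + 1) - 1)) = 1 :=
      ZMod.pow_card_sub_one_eq_one (Units.ne_zero a)
    rw [MulChar.pow_apply_coe, MulChar.one_apply_coe, ← map_pow, ha, map_one]
  have hdvd : p ^ j ∣ p ^ (0 + 1) - 1 := by rw [← hj]; exact orderOf_dvd_of_pow_eq_one hpow
  have hj0 : j = 0 := by
    by_contra hj0
    have hpd : p ∣ p ^ (0 + 1) - 1 := (dvd_pow_self p hj0).trans hdvd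
    have hp1 : p ∣ p ^ (0 + 1) := by rw [zero_add, pow_one]
    have h1 : p ∣ 1 := by
      have := Nat.dvd_sub hp1 hpd
      rwa [Nat.sub_sub_self (Nat.one_le_pow _ _ hpP.pos)] at this
    exact hpP.one_lt.ne' (Nat.dvd_one.mp h1)
  rw [hj0, pow_zero, orderOf_eq_one_iff] at hj
  exact hj

end Legendre

/-! ### §3 Transport of the rational symbol sum along `ι⁻¹` -/

section Transport

variable {p : ℕ} [hp : Fact p.Prime] (ι : PadicAlgCl p ≃+* ℂ)

/-- **`ι⁻¹` of the complex symbol sum `Σ_b (θ⁻¹ε)(b)[b/p^{m+1}]⁺_f` is the Mazur–Tate–Teitelbaum sum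
`Σ_b χ_θ(b)·ω(b)^{(p−1)/2}·[b/p^{m+1}]⁺_f` in `ℂ_p`** (`χ_θ` the twin of `θ`, `ω^{(p−1)/2} = (·/p)` by
Euler's criterion; the symbols are rational and the Legendre values integers, both fixed by `ι`).
[cite: MazurTateTeitelbaum1986Invent, §I.13–I.14 (14.3)] [cite: Disegni2017, Theorem A (arXiv v3 PDF 7–8)] -/
theorem coe_symm_ratTwistedSymbolSum (hp2 : p ≠ 2) {N : ℕ} (f : CuspForm (Gamma0 N) 2) {m : ℕ}
    (hm : cyclotomicExponent p ≤ m + 1) (θ : DirichletCharacter ℂ (p ^ (m + 1))) :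
    ((ι.symm (ratTwistedSymbolSum f (θ⁻¹ * legendreLevel p (m + 1) (Nat.succ_ne_zero m))) :
        PadicAlgCl p) : ℂ_[p]) =
      ∑ b : ZMod (p ^ (m + 1)),
        ((θ⁻¹.ringHomComp ι.symm.toRingHom).ringHomComp (algebraMap (PadicAlgCl p) ℂ_[p])) b *
          algebraMap ℚ_[p] ℂ_[p] (teichWeight p (p / 2)
            (ZMod.castHom (pow_dvd_pow p hm) (ZMod (p ^ cyclotomicExponent p)) b)) *
          (ratPlusSymbol f ((b.val : ℚ) / ((p ^ (m + 1) : ℕ) : ℚ)) : ℂ_[p]) := by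
  rw [ratTwistedSymbolSum, map_sum, PadicComplex.coe_eq, map_sum]
  refine Finset.sum_congr rfl fun b _ ↦ ?_
  rw [MulChar.coeToFun_mul, Pi.mul_apply, legendreLevel_apply p, teichWeight_half_castHom p hp2 hm,
    map_mul, map_mul, map_mul, map_mul, MulChar.ringHomComp_apply, MulChar.ringHomComp_apply,
    map_intCast, map_intCast, map_ratCast, map_ratCast, map_intCast]
  push_cast
  rfl

end Transport

/-! ### §4 The main value identity: Disegni's line value = constant × two branch values -/

section Main

variable {p : ℕ} [hp : Fact p.Prime] (ι : PadicAlgCl p ≃+* ℂ)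

/-- At `p ≡ 1 (mod 4)` the quadratic character of level `p^n` is even: `ε(−1) = (−1/p) = 1`.
[cite: Disegni2017, Theorem A (arXiv v3 PDF 8)] -/
theorem legendreLevel_neg_one (hp4 : p % 4 = 1) {n : ℕ} (hn : n ≠ 0) :
    legendreLevel p n hn (-1) = 1 := by
  have hpP : p.Prime := hp.out
  have hp2 : p ≠ 2 := by intro h; rw [h] at hp4; norm_num at hp4
  haveI : NeZero (p ^ n) := ⟨pow_ne_zero _ hpP.ne_zero⟩
  have hlt : 1 < p ^ n := Nat.one_lt_pow hn hpP.one_lt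
  haveI : Fact (1 < p ^ n) := ⟨hlt⟩
  rw [legendreLevel_apply p hn]
  have hneg : (-1 : ZMod (p ^ n)).val = p ^ n - 1 := by
    rw [ZMod.neg_val, if_neg one_ne_zero, ZMod.val_one]
  have hval : ((-1 : ZMod (p ^ n)).val : ℤ) = (p : ℤ) ^ n - 1 := by
    rw [hneg, Nat.cast_sub hlt.le]
    push_cast
    ring
  have key : ((p : ℤ) ^ n - 1) % (p : ℤ) = (-1 : ℤ) % (p : ℤ) := by
    have hdvd : (p : ℤ) ∣ ((p : ℤ) ^ n - 1) - (-1) := by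
      rw [sub_neg_eq_add, sub_add_cancel]
      exact dvd_pow_self (p : ℤ) hn
    have hmod : (-1 : ℤ) ≡ (p : ℤ) ^ n - 1 [ZMOD (p : ℤ)] := Int.modEq_iff_dvd.mpr hdvd
    exact hmod.symm
  rw [hval, legendreSym.mod, key, ← legendreSym.mod, legendreSym.at_neg_one hp2,
    ZMod.χ₄_nat_one_mod_four hp4, Int.cast_one]

/-- **STEP A — Disegni's interpolation value on the cyclotomic line is a constant times the product of
two Mazur–Tate–Teitelbaum branch values** (`p ≡ 1 (mod 4)`, even branch `ω^{(p−1)/2}`). For two rational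
newforms `f, f′`, an even character `θ` mod `p^{m+1}` of `p`-power order, primitive unless `m = 0`, and
entire continuations `Λ₁`, `Λ₂` of `L(f ⊗ θε, s)`, `L(f′ ⊗ θε, s)`:
`cycLineValue ι α θ Car (Λ₁(1)·Λ₂(1)) = ι⁻¹(u · Car · Ω⁺_f · Ω⁺_{f′}) · v_f(χ_θ) · v_{f′}(χ_θ)` with
`v_g(χ_θ) = α^{−(m+1)} Σ_b χ_θ(b) ω(b)^{(p−1)/2} [b/p^{m+1}]⁺_g` the right-hand side of the tree's
interpolation theorem for the `ω^{(p−1)/2}`-branch at the twin `χ_θ`. Ingredients: Birch's formula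
(`ratTwistedSymbolSum_mul_plusPeriod_holds`) at the even primitive character `θ⁻¹ε` for `f` and `f′`,
Euler's criterion (§1), transport along `ι⁻¹` (§3). [cite: Disegni2017, Theorem A (arXiv v3 PDF 7–8)]
[cite: MazurTateTeitelbaum1986Invent, §I.8 (8.6), §I.14 (14.3)] -/
theorem cycLineValue_eq_const_mul_branchValues (hp4 : p % 4 = 1) {m : ℕ}
    (hm : cyclotomicExponent p ≤ m + 1)
    (θ : DirichletCharacter ℂ (p ^ (m + 1))) (heven : θ.Even) (hord : ∃ j : ℕ, orderOf θ = p ^ j)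
    (hprim : θ.IsPrimitive ∨ m = 0)
    {N N' : ℕ} [NeZero N] [NeZero N'] {f : CuspForm (Gamma0 N) 2} {f' : CuspForm (Gamma0 N') 2}
    (hf : IsNewform0 f) (hQ : coeffField f = ⊥) (hf' : IsNewform0 f') (hQ' : coeffField f' = ⊥)
    (α : ℚ_[p]) (Car : ℝ) {Λ₁ Λ₂ : ℂ → ℂ} (hΛ₁ : Differentiable ℂ Λ₁)
    (hΛ₁' : ∀ s : ℂ, 2 < s.re →
      Λ₁ s = twistedLSeries f (θ * legendreLevel p (m + 1) (Nat.succ_ne_zero m)) s)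
    (hΛ₂ : Differentiable ℂ Λ₂)
    (hΛ₂' : ∀ s : ℂ, 2 < s.re →
      Λ₂ s = twistedLSeries f' (θ * legendreLevel p (m + 1) (Nat.succ_ne_zero m)) s) :
    cycLineValue ι α θ Car (Λ₁ 1 * Λ₂ 1) =
      ((ι.symm ((splitLocalConstant p : ℂ) * (Car : ℂ) * (plusPeriod f : ℂ) * (plusPeriod f' : ℂ)) :
          PadicAlgCl p) : ℂ_[p]) *
        (algebraMap ℚ_[p] ℂ_[p] (α⁻¹ ^ (m + 1)) *
          ∑ b : ZMod (p ^ (m + 1)),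
            ((θ⁻¹.ringHomComp ι.symm.toRingHom).ringHomComp (algebraMap (PadicAlgCl p) ℂ_[p])) b *
              algebraMap ℚ_[p] ℂ_[p] (teichWeight p (p / 2)
                (ZMod.castHom (pow_dvd_pow p hm) (ZMod (p ^ cyclotomicExponent p)) b)) *
              (ratPlusSymbol f ((b.val : ℚ) / ((p ^ (m + 1) : ℕ) : ℚ)) : ℂ_[p])) *
        (algebraMap ℚ_[p] ℂ_[p] (α⁻¹ ^ (m + 1)) *
          ∑ b : ZMod (p ^ (m + 1)),
            ((θ⁻¹.ringHomComp ι.symm.toRingHom).ringHomComp (algebraMap (PadicAlgCl p) ℂ_[p])) b *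
              algebraMap ℚ_[p] ℂ_[p] (teichWeight p (p / 2)
                (ZMod.castHom (pow_dvd_pow p hm) (ZMod (p ^ cyclotomicExponent p)) b)) *
              (ratPlusSymbol f' ((b.val : ℚ) / ((p ^ (m + 1) : ℕ) : ℚ)) : ℂ_[p])) := by
  have hpP : p.Prime := hp.out
  have hp2 : p ≠ 2 := by intro h; rw [h] at hp4; norm_num at hp4
  set ε := legendreLevel p (m + 1) (Nat.succ_ne_zero m) with hε
  set ϑ := θ⁻¹ * ε with hϑ
  -- parity of `ϑ`
  have hεinv : ε⁻¹ = ε := legendreLevel_inv p (Nat.succ_ne_zero m)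
  have hϑeven : ϑ.Even := by
    rw [DirichletCharacter.Even, hϑ, MulChar.coeToFun_mul, Pi.mul_apply, MulChar.inv_apply_eq_inv',
      heven, inv_one, one_mul, hε, legendreLevel_neg_one hp4]
  -- primitivity of `ϑ`
  have hϑprim : ϑ.IsPrimitive := by
    rcases Nat.eq_zero_or_pos m with hm0 | hmpos
    · subst hm0
      have hθ1 : θ = 1 := eq_one_of_orderOf_eq_prime_pow_level_prime p hord
      rw [hϑ, hθ1, inv_one, one_mul, hε]
      exact legendreLevel_one_isPrimitive p hp2
    · have hθ : θ.IsPrimitive := hprim.resolve_right (by omega)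
      exact isPrimitive_inv_mul_legendreLevel p hmpos hθ
  -- Birch's formula for `f` and `f′` at `ϑ` (`ϑ⁻¹ = θ ε`)
  have hϑinv : ϑ⁻¹ = θ * ε := by rw [hϑ, mul_inv, inv_inv, hεinv]
  have hB₁ := ratTwistedSymbolSum_mul_plusPeriod_holds hf hQ hϑprim hϑeven hΛ₁
    (fun s hs ↦ by rw [hϑinv]; exact hΛ₁' s hs)
  have hB₂ := ratTwistedSymbolSum_mul_plusPeriod_holds hf' hQ' hϑprim hϑeven hΛ₂
    (fun s hs ↦ by rw [hϑinv]; exact hΛ₂' s hs)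
  -- the complex identity
  have hC : cycLineComplexPart (p := p) θ Car (Λ₁ 1 * Λ₂ 1) =
      ((splitLocalConstant p : ℂ) * (Car : ℂ) * (plusPeriod f : ℂ) * (plusPeriod f' : ℂ)) *
        ratTwistedSymbolSum f ϑ * ratTwistedSymbolSum f' ϑ := by
    rw [cycLineComplexPart, ← hε, ← hϑ]
    calc (splitLocalConstant p : ℂ) * gaussSum ϑ (ZMod.stdAddChar (N := p ^ (m + 1))) ^ 2 * (Car : ℂ) *
          (Λ₁ 1 * Λ₂ 1)
        = (splitLocalConstant p : ℂ) * (Car : ℂ) *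
            (gaussSum ϑ (ZMod.stdAddChar (N := p ^ (m + 1))) * Λ₁ 1) *
            (gaussSum ϑ (ZMod.stdAddChar (N := p ^ (m + 1))) * Λ₂ 1) := by ring
      _ = (splitLocalConstant p : ℂ) * (Car : ℂ) * (ratTwistedSymbolSum f ϑ * (plusPeriod f : ℂ)) *
            (ratTwistedSymbolSum f' ϑ * (plusPeriod f' : ℂ)) := by rw [hB₁, hB₂]
      _ = _ := by ring
  -- transport to `ℂ_p`
  rw [cycLineValue, hC, map_mul, map_mul, PadicComplex.coe_eq, map_mul, map_mul, ← PadicComplex.coe_eq,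
    ← PadicComplex.coe_eq, ← PadicComplex.coe_eq, hϑ, hε, coe_symm_ratTwistedSymbolSum ι hp2 f hm θ,
    coe_symm_ratTwistedSymbolSum ι hp2 f' hm θ, pow_mul', sq, map_mul]
  ring

end Main

end Summit.BirchSwinnertonDyer.Rank1Residual.Additive

end
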